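import Summits.Ventures.PercRepro.C026C028Recursion
import Summits.Ventures.PercRepro.C026ProbeTransfer

/-!
# The reduction in sure-cluster form: C-028(c) everywhere from the single step (A) (p6, gen 15;
mine-3 MINE3-GLUING v4 §7 (5), the faithful weight-world image of the contraction induction)

mine-3's induction contracts edges at the mark `a`; in the weight vocabulary a contracted edge is a
surely-open edge (`p e = 1`), so "the mark `a`" becomes its **sure cluster** `{v | SureConn p a v}`.
The induction runs on the fractional edges (`fracEdges`) and always picks one touching the sure cluster
of `a`: inside the cluster the two minors agree (`C028At_of_sureConn_endpoints`), into the sure cluster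
of `b` it is a sure `a`–`b` edge (`C028At_of_sureEdge_ab`), into the sure cluster of `c` it is a sure
mark–`c` edge (`C028At_of_sureEdge_ac`, the mark–`c` step of `C026C028Recursion` with every identity
holding almost surely), and otherwise it is the step (A) in sure-cluster form (`C028StepSure`, the
hypothesis).  When no fractional edge touches the sure cluster of `a`, the event `{a ↔ b}` is
deterministic and the defect vanishes (`C028At_of_no_fracEdge_at_cluster`).  Hence
**`C028At_of_stepSure`: (A) in sure-cluster form ⟹ ROW C-028(c) on every marked multigraph at every
weight vector**, and C-026 with it (`C026At_of_stepSure`).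
-/

namespace PercRepro

open Finset

namespace MultiGraph

variable {V E : Type*} (G : MultiGraph V E) [Fintype E] [DecidableEq E]

/-! ### Almost-sure bookkeeping at a fractional edge -/

/-- Positive-weight configurations with `e` forced open join `a` and `c` when `a` is surely joined to
one end of `e` and `c` to the other. -/
theorem conn_update_true_of_sure {p : E → ℝ} {e : E} (he : p e ≠ 1) {a c : V}
    (hs : (G.SureConn p a (G.fst e) ∧ G.SureConn p c (G.snd e)) ∨
      (G.SureConn p a (G.snd e) ∧ G.SureConn p c (G.fst e)))
    {ω : Config E} (hω : 0 < weight p ω) : G.Conn (Function.update ω e true) a c := by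
  have hopen : Function.update ω e true e = true := by simp
  have hxy := Conn.of_openAdj (G.openAdj_of_open e hopen)
  rcases hs with ⟨ha, hc⟩ | ⟨ha, hc⟩
  · exact ((G.conn_update_of_sureConn_of_weight_pos hω he true ha).trans hxy).trans
      (G.conn_update_of_sureConn_of_weight_pos hω he true hc).symm
  · exact ((G.conn_update_of_sureConn_of_weight_pos hω he true ha).trans hxy.symm).trans
      (G.conn_update_of_sureConn_of_weight_pos hω he true hc).symm

/-- An event inside `{a ↮ c}` has probability `0` at `p[e:=1]` when `e` surely joins `a` and `c`. -/
theorem prob_update_one_eq_zero_of_subset_sep_sure {p : E → ℝ} (hp : IsProb p) {e : E}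
    (he : p e ≠ 1) {a c : V}
    (hs : (G.SureConn p a (G.fst e) ∧ G.SureConn p c (G.snd e)) ∨
      (G.SureConn p a (G.snd e) ∧ G.SureConn p c (G.fst e)))
    {X : Set (Config E)} (hX : X ⊆ G.sepEvent a c) : prob (Function.update p e 1) X = 0 := by
  rw [prob_update_one_eq_prob_lift]
  have : prob p (lift e true X) = prob p ∅ := by
    refine prob_eq_of_eqOn_pos hp fun ω hω => ?_
    simp only [mem_lift, Set.mem_empty_iff_false, iff_false]
    intro h
    exact (G.mem_sepEvent.1 (hX h)) (G.conn_update_true_of_sure he hs hω)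
  rw [this, prob_empty]

/-- The three rows `ab|c`, `bc|a`, `a|b|c` vanish at `p[e:=1]` when `e` surely joins `a` and `c`. -/
theorem rows_update_one_of_sure_ac {p : E → ℝ} (hp : IsProb p) {e : E} (he : p e ≠ 1) {a c : V}
    (hs : (G.SureConn p a (G.fst e) ∧ G.SureConn p c (G.snd e)) ∨
      (G.SureConn p a (G.snd e) ∧ G.SureConn p c (G.fst e))) (b : V) :
    G.law3 (Function.update p e 1) a b c 1 = 0 ∧ G.law3 (Function.update p e 1) a b c 3 = 0 ∧
      G.law3 (Function.update p e 1) a b c 4 = 0 := by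
  refine ⟨?_, ?_, ?_⟩
  · rw [law3_one, G.partitionEvent_row_ab_c]
    exact G.prob_update_one_eq_zero_of_subset_sep_sure hp he hs Set.inter_subset_right
  · rw [law3_three, G.partitionEvent_row_bc_a]
    refine G.prob_update_one_eq_zero_of_subset_sep_sure hp he hs fun ω hω => ?_
    rw [Set.mem_inter_iff, mem_connEvent, mem_sepEvent] at hω
    rw [mem_sepEvent]
    intro hac
    exact hω.2 (hac.trans hω.1.symm)
  · rw [law3_four, G.partitionEvent_row_a_b_c]
    exact G.prob_update_one_eq_zero_of_subset_sep_sure hp he hs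
      (Set.inter_subset_left.trans Set.inter_subset_right)

/-- Almost surely, `a ↔ b` with `e` forced open iff `a ↔ b` or `c ↔ b` with `e` forced closed, when `e`
surely joins `a` and `c`. -/
theorem conn_update_true_ab_iff_of_sure {p : E → ℝ} {e : E} (he : p e ≠ 1) {a c : V}
    (hs : (G.SureConn p a (G.fst e) ∧ G.SureConn p c (G.snd e)) ∨
      (G.SureConn p a (G.snd e) ∧ G.SureConn p c (G.fst e)))
    (b : V) {ω : Config E} (hω : 0 < weight p ω) :
    G.Conn (Function.update ω e true) a b ↔
      G.Conn (Function.update ω e false) a b ∨ G.Conn (Function.update ω e false) c b := by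
  have hidem : Function.update ω e true =
      Function.update (Function.update ω e false) e true := by
    rw [Function.update_idem]
  rw [hidem, conn_update_true_iff]
  rcases hs with ⟨ha, hc⟩ | ⟨ha, hc⟩
  · have hax := G.conn_update_of_sureConn_of_weight_pos hω he false ha
    have hcy := G.conn_update_of_sureConn_of_weight_pos hω he false hc
    constructor
    · rintro (h | ⟨_, h2⟩ | ⟨_, h2⟩)
      · exact Or.inl h
      · exact Or.inr (hcy.trans h2)
      · exact Or.inl (hax.trans h2)
    · rintro (h | h)
      · exact Or.inl h
      · exact Or.inr (Or.inl ⟨hax, hcy.symm.trans h⟩)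
  · have hay := G.conn_update_of_sureConn_of_weight_pos hω he false ha
    have hcx := G.conn_update_of_sureConn_of_weight_pos hω he false hc
    constructor
    · rintro (h | ⟨_, h2⟩ | ⟨_, h2⟩)
      · exact Or.inl h
      · exact Or.inl (hay.trans h2)
      · exact Or.inr (hcx.trans h2)
    · rintro (h | h)
      · exact Or.inl h
      · exact Or.inr (Or.inr ⟨hay, hcx.symm.trans h⟩)

/-- `I_A = Y_b(p[e:=0])` when `e` surely joins `a` and `c`. -/
theorem pivA26_eq_of_sure_ac {p : E → ℝ} (hp : IsProb p) {e : E} (he : p e ≠ 1) {a c : V}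
    (hs : (G.SureConn p a (G.fst e) ∧ G.SureConn p c (G.snd e)) ∨
      (G.SureConn p a (G.snd e) ∧ G.SureConn p c (G.fst e))) (b : V) :
    G.pivA26 p e a b c = G.law3 (Function.update p e 0) a b c 3 := by
  rw [pivA26_eq, prob_update_one_eq_prob_lift, prob_update_zero_eq_prob_lift, law3_three,
    G.partitionEvent_row_bc_a, prob_update_zero_eq_prob_lift]
  have h1 : prob p (lift e true (G.connEvent a b)) =
      prob p (lift e false (G.connEvent a b ∪ G.connEvent c b)) := by
    refine prob_eq_of_eqOn_pos hp fun ω hω => ?_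
    simp only [mem_lift, Set.mem_union, mem_connEvent]
    exact G.conn_update_true_ab_iff_of_sure he hs b hω
  rw [h1]
  have h2 := prob_diff p (lift e false (G.connEvent a b ∪ G.connEvent c b))
    (lift e false (G.connEvent a b))
  have h3 : lift e false (G.connEvent a b ∪ G.connEvent c b) ∩ lift e false (G.connEvent a b) =
      lift e false (G.connEvent a b) := by
    ext ω
    simp only [Set.mem_inter_iff, mem_lift, Set.mem_union, mem_connEvent]
    tauto
  have h4 : lift e false (G.connEvent a b ∪ G.connEvent c b) \ lift e false (G.connEvent a b) =
      lift e false (G.connEvent b c ∩ G.sepEvent a b) := by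
    ext ω
    simp only [Set.mem_sdiff, mem_lift, Set.mem_union, Set.mem_inter_iff, mem_connEvent, mem_sepEvent]
    constructor
    · rintro ⟨h, hn⟩
      refine ⟨?_, hn⟩
      rcases h with h | h
      · exact absurd h hn
      · exact h.symm
    · rintro ⟨h, hn⟩
      exact ⟨Or.inr h.symm, hn⟩
  rw [h3, h4] at h2
  linarith

/-- **The sure mark–`c` step**: when the fractional edge `e` surely joins `a` and the probe `c`, C-028(c)
at `p[e:=0]` implies C-028(c) at `p`. -/
theorem C028At_of_sureEdge_ac {p : E → ℝ} (hp : IsProb p) {e : E} (he : p e ≠ 1) {a c : V}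
    (hs : (G.SureConn p a (G.fst e) ∧ G.SureConn p c (G.snd e)) ∨
      (G.SureConn p a (G.snd e) ∧ G.SureConn p c (G.fst e))) (b : V)
    (h0 : G.C028At (Function.update p e 0) a b c) : G.C028At p a b c := by
  have hp0 : IsProb (Function.update p e 0) := hp.update e ⟨le_rfl, zero_le_one⟩
  obtain ⟨r1, r3, r4⟩ := G.rows_update_one_of_sure_ac hp he hs b
  have hpA := G.pivA26_eq_of_sure_ac hp he hs b
  -- the rows of the contraction minor
  have hsum1 := law3_sum_eq_one G (Function.update p e 1) a b c
  have hd1 : G.c028Cov (Function.update p e 1) a b c = 0 := by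
    unfold c028Cov
    rw [r1, r3]
    rw [r1, r3, r4] at hsum1
    have hx : G.law3 (Function.update p e 1) a b c 0 +
        G.law3 (Function.update p e 1) a b c 2 = 1 := by linarith
    linear_combination (-(G.law3 (Function.update p e 1) a b c 0)) * hx
  have hpD : G.pivD26 p e a b c =
      G.law3 (Function.update p e 0) a b c 1 + G.law3 (Function.update p e 0) a b c 4 := by
    unfold pivD26
    rw [r1, r4]
    ring
  have hY2 : G.law3 (Function.update p e 1) a b c 2 =
      G.law3 (Function.update p e 0) a b c 2 + G.law3 (Function.update p e 0) a b c 4 := by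
    have hA1 := G.law3_two_add_three_add_four (Function.update p e 1) a b c
    have hA0 := G.law3_two_add_three_add_four (Function.update p e 0) a b c
    have hpiv := hpA
    rw [pivA26_eq] at hpiv
    have hs1 : prob (Function.update p e 1) (G.sepEvent a b) =
        1 - prob (Function.update p e 1) (G.connEvent a b) := prob_compl _ _
    have hs0 : prob (Function.update p e 0) (G.sepEvent a b) =
        1 - prob (Function.update p e 0) (G.connEvent a b) := prob_compl _ _
    rw [r3, r4] at hA1
    linarith
  have hd : G.c028Cov p a b c =
      (1 - p e) * (G.c028Cov (Function.update p e 0) a b c +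
        p e * (G.law3 (Function.update p e 0) a b c 1 + G.law3 (Function.update p e 0) a b c 4) *
          G.law3 (Function.update p e 0) a b c 3) := by
    rw [G.c028Cov_rec p e a b c, hd1, hpA, hpD]
    ring
  have h2 : G.law3 p a b c 2 =
      G.law3 (Function.update p e 0) a b c 2 + p e * G.law3 (Function.update p e 0) a b c 4 := by
    rw [G.law3_split_edge p e a b c 2, hY2]
    ring
  have h3 : G.law3 p a b c 3 = (1 - p e) * G.law3 (Function.update p e 0) a b c 3 := by
    rw [G.law3_split_edge p e a b c 3, r3]
    ring
  unfold C028At at h0 ⊢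
  rw [hd, h2, h3]
  exact c028_markc_core (hp e).1 (hp e).2 (prob_nonneg hp0 _) (prob_nonneg hp0 _)
    (prob_nonneg hp0 _) (add_nonneg (prob_nonneg hp0 _) (prob_nonneg hp0 _)) h0
    (G.law3_four_ge_mul hp0 a b c)

/-! ### The sure `a`–`b` step -/

/-- When `e` surely joins `a` and `b`, `a ↔ b` is sure at `p[e:=1]`. -/
theorem prob_update_one_connEvent_eq_one_of_sure_ab {p : E → ℝ} (hp : IsProb p) {e : E}
    (he : p e ≠ 1) {a b : V}
    (hs : (G.SureConn p a (G.fst e) ∧ G.SureConn p b (G.snd e)) ∨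
      (G.SureConn p a (G.snd e) ∧ G.SureConn p b (G.fst e))) :
    prob (Function.update p e 1) (G.connEvent a b) = 1 := by
  rw [prob_update_one_eq_prob_lift, ← prob_univ p]
  refine prob_eq_of_eqOn_pos hp fun ω hω => ?_
  simp only [mem_lift, mem_connEvent, Set.mem_univ, iff_true]
  exact G.conn_update_true_of_sure he hs hω

/-- When `e` surely joins `a` and `b`, `I_B = 0`: opening `e` does not help `c` reach a mark. -/
theorem pivD26_eq_zero_of_sure_ab {p : E → ℝ} (hp : IsProb p) {e : E} (he : p e ≠ 1) {a b : V}
    (hs : (G.SureConn p a (G.fst e) ∧ G.SureConn p b (G.snd e)) ∨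
      (G.SureConn p a (G.snd e) ∧ G.SureConn p b (G.fst e))) (c : V) :
    G.pivD26 p e a b c = 0 := by
  rw [pivD26_eq_rowsB, G.law3_zero_add_two_add_three, G.law3_zero_add_two_add_three,
    prob_update_one_eq_prob_lift, prob_update_zero_eq_prob_lift]
  rw [prob_eq_of_eqOn_pos hp (Y := lift e false (G.connEvent c a ∪ G.connEvent c b)) ?_, sub_self]
  intro ω hω
  simp only [mem_lift, Set.mem_union, mem_connEvent]
  have hidem : Function.update ω e true =
      Function.update (Function.update ω e false) e true := by
    rw [Function.update_idem]
  rw [hidem, conn_update_true_iff, conn_update_true_iff]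
  have hle : Function.update ω e false ≤ Function.update ω e true := by
    intro e'
    by_cases h : e' = e
    · subst h; simp
    · simp [Function.update_of_ne h]
  rcases hs with ⟨ha, hb⟩ | ⟨ha, hb⟩
  · have hax := G.conn_update_of_sureConn_of_weight_pos hω he false ha
    have hby := G.conn_update_of_sureConn_of_weight_pos hω he false hb
    constructor
    · rintro ((h | ⟨h1, _⟩ | ⟨h1, _⟩) | (h | ⟨h1, _⟩ | ⟨h1, _⟩))
      · exact Or.inl h
      · exact Or.inl (h1.trans hax.symm)
      · exact Or.inr (h1.trans hby.symm)
      · exact Or.inr h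
      · exact Or.inl (h1.trans hax.symm)
      · exact Or.inr (h1.trans hby.symm)
    · rintro (h | h)
      · exact Or.inl (Or.inl h)
      · exact Or.inr (Or.inl h)
  · have hay := G.conn_update_of_sureConn_of_weight_pos hω he false ha
    have hbx := G.conn_update_of_sureConn_of_weight_pos hω he false hb
    constructor
    · rintro ((h | ⟨h1, _⟩ | ⟨h1, _⟩) | (h | ⟨h1, _⟩ | ⟨h1, _⟩))
      · exact Or.inl h
      · exact Or.inr (h1.trans hbx.symm)
      · exact Or.inl (h1.trans hay.symm)
      · exact Or.inr h
      · exact Or.inr (h1.trans hbx.symm)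
      · exact Or.inl (h1.trans hay.symm)
    · rintro (h | h)
      · exact Or.inl (Or.inl h)
      · exact Or.inr (Or.inl h)

/-- **The sure `a`–`b` step**: when the fractional edge `e` surely joins the marks `a` and `b`, C-028(c)
at `p[e:=0]` implies C-028(c) at `p`. -/
theorem C028At_of_sureEdge_ab {p : E → ℝ} (hp : IsProb p) {e : E} (he : p e ≠ 1) {a b : V}
    (hs : (G.SureConn p a (G.fst e) ∧ G.SureConn p b (G.snd e)) ∨
      (G.SureConn p a (G.snd e) ∧ G.SureConn p b (G.fst e))) (c : V)
    (h0 : G.C028At (Function.update p e 0) a b c) : G.C028At p a b c := by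
  have hp1 : IsProb (Function.update p e 1) := hp.update e ⟨zero_le_one, le_rfl⟩
  have hA := G.prob_update_one_connEvent_eq_one_of_sure_ab hp he hs
  have hsep := G.law3_two_add_three_add_four (Function.update p e 1) a b c
  have hs' : prob (Function.update p e 1) (G.sepEvent a b) =
      1 - prob (Function.update p e 1) (G.connEvent a b) := prob_compl _ _
  have h2n := prob_nonneg hp1 (G.partitionEvent ![a, b, c] ![0, 1, 0])
  have h3n := prob_nonneg hp1 (G.partitionEvent ![a, b, c] ![0, 1, 1])
  have h4n := prob_nonneg hp1 (G.partitionEvent ![a, b, c] ![0, 1, 2])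
  rw [← law3_two] at h2n
  rw [← law3_three] at h3n
  rw [← law3_four] at h4n
  have h2 : G.law3 (Function.update p e 1) a b c 2 = 0 := by linarith
  have h3 : G.law3 (Function.update p e 1) a b c 3 = 0 := by linarith
  have hx := G.law3_zero_add_one (Function.update p e 1) a b c
  have hd1 : G.c028Cov (Function.update p e 1) a b c = 0 := by
    unfold c028Cov
    rw [h2, h3, hx, hA]
    ring
  have hd : G.c028Cov p a b c = (1 - p e) * G.c028Cov (Function.update p e 0) a b c := by
    rw [G.c028Cov_rec p e a b c, hd1, G.pivD26_eq_zero_of_sure_ab hp he hs c]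
    ring
  have hY2 : G.law3 p a b c 2 = (1 - p e) * G.law3 (Function.update p e 0) a b c 2 := by
    rw [G.law3_split_edge p e a b c 2, h2]
    ring
  have hY3 : G.law3 p a b c 3 = (1 - p e) * G.law3 (Function.update p e 0) a b c 3 := by
    rw [G.law3_split_edge p e a b c 3, h3]
    ring
  have h1q : 0 ≤ 1 - p e := by linarith [(hp e).2]
  unfold C028At at h0 ⊢
  rw [hd, hY2, hY3]
  have hsq : Real.sqrt ((1 - p e) * G.law3 (Function.update p e 0) a b c 2 *
      ((1 - p e) * G.law3 (Function.update p e 0) a b c 3)) =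
      (1 - p e) * Real.sqrt (G.law3 (Function.update p e 0) a b c 2 *
        G.law3 (Function.update p e 0) a b c 3) := by
    rw [show (1 - p e) * G.law3 (Function.update p e 0) a b c 2 *
        ((1 - p e) * G.law3 (Function.update p e 0) a b c 3) =
        (1 - p e) ^ 2 * (G.law3 (Function.update p e 0) a b c 2 *
          G.law3 (Function.update p e 0) a b c 3) by ring,
      Real.sqrt_mul (sq_nonneg _), Real.sqrt_sq h1q]
  rw [hsq]
  exact mul_le_mul_of_nonneg_left h0 h1q

/-! ### An edge inside a sure cluster -/

/-- When the ends of the fractional edge `e` are surely joined, every row of `p[e:=1]` equals the row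
of `p[e:=0]`. -/
theorem law3_update_one_eq_update_zero_of_sureConn_endpoints {p : E → ℝ} (hp : IsProb p) {e : E}
    (he : p e ≠ 1) (hxy : G.SureConn p (G.fst e) (G.snd e)) (a b c : V) (s : Fin 5) :
    G.law3 (Function.update p e 1) a b c s = G.law3 (Function.update p e 0) a b c s := by
  unfold law3
  rw [prob_update_one_eq_prob_lift, prob_update_zero_eq_prob_lift]
  refine prob_eq_of_eqOn_pos hp fun ω hω => ?_
  have hidem : Function.update ω e true =
      Function.update (Function.update ω e false) e true := by
    rw [Function.update_idem]
  have hxy' := G.conn_update_of_sureConn_of_weight_pos hω he false hxy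
  simp only [mem_lift, G.mem_partitionEvent_three a b c, hidem,
    G.conn_update_true_iff_of_conn_endpoints hxy']

/-- When the ends of the fractional edge `e` are surely joined, `I_A = 0`. -/
theorem pivA26_eq_zero_of_sureConn_endpoints {p : E → ℝ} (hp : IsProb p) {e : E} (he : p e ≠ 1)
    (hxy : G.SureConn p (G.fst e) (G.snd e)) (a b c : V) : G.pivA26 p e a b c = 0 := by
  rw [pivA26_eq, prob_update_one_eq_prob_lift, prob_update_zero_eq_prob_lift]
  rw [prob_eq_of_eqOn_pos hp (Y := lift e false (G.connEvent a b)) ?_, sub_self]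
  intro ω hω
  have hidem : Function.update ω e true =
      Function.update (Function.update ω e false) e true := by
    rw [Function.update_idem]
  have hxy' := G.conn_update_of_sureConn_of_weight_pos hω he false hxy
  simp only [mem_lift, mem_connEvent, hidem, G.conn_update_true_iff_of_conn_endpoints hxy']

/-- **The step inside a sure cluster**: when the ends of the fractional edge `e` are surely joined,
C-028(c) at `p[e:=0]` implies C-028(c) at `p`. -/
theorem C028At_of_sureConn_endpoints {p : E → ℝ} (hp : IsProb p) {e : E} (he : p e ≠ 1)
    (hxy : G.SureConn p (G.fst e) (G.snd e)) {a b c : V}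
    (h0 : G.C028At (Function.update p e 0) a b c) : G.C028At p a b c := by
  have hrow := G.law3_update_one_eq_update_zero_of_sureConn_endpoints hp he hxy a b c
  have hd1 : G.c028Cov (Function.update p e 1) a b c = G.c028Cov (Function.update p e 0) a b c := by
    unfold c028Cov
    rw [hrow 0, hrow 1, hrow 2, hrow 3]
  have hd : G.c028Cov p a b c = G.c028Cov (Function.update p e 0) a b c := by
    rw [G.c028Cov_rec p e a b c, hd1, G.pivA26_eq_zero_of_sureConn_endpoints hp he hxy]
    ring
  have h2 : G.law3 p a b c 2 = G.law3 (Function.update p e 0) a b c 2 := by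
    rw [G.law3_split_edge p e a b c 2, hrow 2]
    ring
  have h3 : G.law3 p a b c 3 = G.law3 (Function.update p e 0) a b c 3 := by
    rw [G.law3_split_edge p e a b c 3, hrow 3]
    ring
  unfold C028At at h0 ⊢
  rw [hd, h2, h3]
  exact h0

end MultiGraph

end PercRepro
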